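import Summits.QuantumFields.BalabanUV.T4Continuum.Support.NE7FlatHkCurlLetter
import HarnessLib

/-!
# NE7FlatHkCurlLetterHolonomy — THE (R7♭) LETTER IN THE T⁴ AVERAGE's OWN UNITS: a coarse datum `Φ` prescribed for the linearised `(j+1)`-fold average
# (`cpushIter`, holonomy units) is lifted EXACTLY by `R_H(M⁻¹Φ)`, whose fine curvature is `≤ card n·C_LIN(d)·sup‖coarse curl of Φ‖ ∕ M²` — TWO powers of
# `M = L^{j+1}`, not one; file 35 (the pricing of the (L1) letter of the curved (APE))

Cell `pub-balaban`, rung (B)+1 sub-cell t4, lineage `b2b-balaban-t4-ne7-p1` (CRUX PROVER NE7 #1 = OWNER of row NE7), generation 78; memo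
`t4/b2b-balaban-t4-ne7-p1-g78/BUMP-CLASS-FLAT.md` §5∕§7.  File F104 (a corollary of F36 `NE7FlatHkRightInverse.cpushIter_flat_hkPull` and F37
`NE7FlatHkCurlLetter.norm_curlAt_flat_hkRightInverse_le`, by linearity of lit-balaban's plaquette field `Fs`).
WHY (memo §5∕§7).  The (L1) letter of the curved (APE) (F86's `hNlift`) lifts the coarse datum `φ = dirIter_W Z` of the representative to a fine field `A_N` with
`dirIter A_N = φ` and prices its fine CURL `c_N`, which enters the (APE)'s plaquette radius ADDITIVELY (budget `≍ small∕M²`).  Gen 77 (memo `GAUGED-TOP-TT.md` §3) priced the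
lift of the `O(θ_u²)` second-order (BCH) part of E′'s datum at `c_N ≍ θ_u²∕M` and declared the unpinned E′ road dead at (L1).  F36∕F37 state the tree's right inverse for
a datum `B` in lit-balaban's AVERAGE units (`cpushIter(R_H B) = M·B`, fine curl `≤ card n·C∕M·sup‖Fs M 1 B‖`); THIS FILE restates them for a datum in the T⁴ average's own
(holonomy) units: `cpushIter(R_H(M⁻¹Φ)) = Φ` and fine curl `≤ card n·C·sup‖Fs M 1 Φ‖∕M²`.  So a level-uniform datum with level-uniform coarse curl `K` costs
`c_N ≤ card n·C_LIN(d)·K∕M²` — the closing order: the E′ road's (L1) is priced at `θ_u²∕M²`, NOT `θ_u²∕M` (the North and slice clauses of `hNlift` are not touched here).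
WHAT ([folklore]; 0 def, 0 sorry; dimension written `d + 1` as in F36∕F37).  `Fs_one_entry_smul` (linearity, entrywise); **`hkRightInverse_holonomy_units`** — exactness and
the curl letter with `M⁻²` for the lift `R_H(M⁻¹Φ)`.
HONEST FRAMING (page 1): a units bookkeeping corollary at the FLAT background (abelian, `U = 1`); the curved lift, the North bound, the slice membership, α₁, (L2) are NOT
here; nothing of Bałaban's asserted; (APE) NOT proved; NOT ONE-STEP, NOT NE7; spine 0∕9; finite T⁴ rung (B)+1 — NOT infinite volume, NOT mass gap, NOT `BetaPertH`, NOT Clay.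
Continuum YM on T⁴ ⇐ BetaPertH ∧ nine spine estimates (0/9 proved); BetaPertH ⇐ (D1) ∧ (D4) ∧ CAP+tail; G-an2-4 gates asym, D1 and NE2/3/4.
-/

set_option autoImplicit false

open scoped BigOperators Matrix Matrix.Norms.L2Operator
open Finset

namespace Summit.QuantumFields.BalabanUV.T4Continuum.NE7FlatHkCurlLetterHolonomy

open Literature.MathematicalPhysics.QuantumFieldTheory.Balaban1983to89
open B7Prop1Explicit (Site e)
open T4AveragingDeficitWall (curlAt)
open B4Sect5Proof (latticeConst)
open B5Prop11Plancherel (Tor fine)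
open B5Action121 (Fs Fs_apply)
open B5Hk163Strip (kappa163)
open B5Hk163Torus (HkOp)
open B5Hk163TorusHolderDecay (CdecD)
open B6LowerBound2153Torus (toT)
open BlockAveragePushDirSplit (flat)
open ReplicationRightInverse (cpushIter)
open SmoothRefineInterp (interp)
open NE3TangentNoGoWords (dPot)
open NE3TangentFlatStructure (framePot)
open NE7FlatHkRightInverse (cpushIter_flat_hkPull)
open NE7FlatHkCurlLetter (norm_curlAt_flat_hkRightInverse_le)

noncomputable section

variable {d : ℕ} {n : Type*} [Fintype n] [DecidableEq n]

omit [Fintype n] [DecidableEq n] in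
/-- Linearity of lit-balaban's plaquette field, read entrywise on a scalar multiple of a matrix-valued coarse field. [folklore] -/
theorem Fs_one_entry_smul (M : Fin (d + 1) → ℕ) [∀ μ, NeZero (M μ)] (s : ℂ) (Φ : Tor M × Fin (d + 1) → Matrix n n ℂ) (i i' : n)
    (μ ν : Fin (d + 1)) (y : Tor M) :
    Fs M 1 (fun p : Tor M × Fin (d + 1) => (s • Φ) p i i') μ ν y = s * Fs M 1 (fun p : Tor M × Fin (d + 1) => Φ p i i') μ ν y := by
  have h : (fun p : Tor M × Fin (d + 1) => (s • Φ) p i i') = s • (fun p : Tor M × Fin (d + 1) => Φ p i i') := by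
    funext p; simp only [Pi.smul_apply, Matrix.smul_apply, smul_eq_mul]
  rw [h]
  simp only [Fs_apply, Pi.smul_apply, smul_eq_mul]
  ring

/-- **THE (R7♭) RIGHT INVERSE IN HOLONOMY UNITS, EXACTNESS**: for a coarse datum `Φ` the lift `R_H(M⁻¹Φ)` (`M = L^{j+1}`; lit-balaban's `H_k` pulled back
entrywise + row NE3's curl-free corrector) satisfies `cpushIter L j 1 (R_H(M⁻¹Φ)) = Φ ∘ toT` EXACTLY. [folklore] -/
theorem cpushIter_hkRightInverse_holonomy {L : ℕ} (hL : 1 ≤ L) (j : ℕ) [NeZero (L ^ (j + 1))] (M : Fin (d + 1) → ℕ) [∀ μ, NeZero (M μ)]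
    (Φ : Tor M × Fin (d + 1) → Matrix n n ℂ) :
    cpushIter L j (flat (d := d + 1) (n := n))
      ((fun (x : Site (d + 1)) (κ : Fin (d + 1)) => Matrix.of fun i i' : n =>
          (HkOp (L ^ (j + 1)) M *ᵥ fun p : Tor M × Fin (d + 1) => ((((((L ^ (j + 1) : ℕ) : ℂ))⁻¹) • Φ) p i i')) (toT (fine (L ^ (j + 1)) M) x, κ))
        + dPot (interp (L ^ (j + 1)) Finset.univ (framePot L (j + 1)
            (fun (x : Site (d + 1)) (κ : Fin (d + 1)) => Matrix.of fun i i' : n =>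
              (HkOp (L ^ (j + 1)) M *ᵥ fun p : Tor M × Fin (d + 1) => ((((((L ^ (j + 1) : ℕ) : ℂ))⁻¹) • Φ) p i i')) (toT (fine (L ^ (j + 1)) M) x, κ)))))
      = (fun (z : Site (d + 1)) (κ : Fin (d + 1)) => Φ (toT M z, κ)) := by
  have hn0 : (((L ^ (j + 1) : ℕ)) : ℂ) ≠ 0 := by exact_mod_cast (NeZero.ne (L ^ (j + 1)))
  have h := cpushIter_flat_hkPull (n := n) hL j M (((((L ^ (j + 1) : ℕ) : ℂ))⁻¹) • Φ)
  refine h.trans ?_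
  funext z κ
  simp only [Pi.smul_apply, smul_smul, mul_inv_cancel₀ hn0, one_smul]

/-- **THE (R7♭) RIGHT INVERSE IN HOLONOMY UNITS, CURL LETTER**: if the entrywise coarse curls of the datum obey `‖Fs M 1 Φ_{ii′} μ ν y‖ ≤ f`, the lift
`R_H(M⁻¹Φ)` has fine curvature `≤ card n·C_LIN(d)·f ∕ M²` at every fine point and plane — TWO powers of `M = L^{j+1}`. [folklore] -/
theorem norm_curlAt_hkRightInverse_holonomy_le [Nonempty n] (L j : ℕ) [NeZero (L ^ (j + 1))] (M : Fin (d + 1) → ℕ) [∀ μ, NeZero (M μ)]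
    (Φ : Tor M × Fin (d + 1) → Matrix n n ℂ) {f : ℝ}
    (hF : ∀ (i i' : n) (y : Tor M) (μ ν : Fin (d + 1)), ‖Fs M 1 (fun p : Tor M × Fin (d + 1) => Φ p i i') μ ν y‖ ≤ f)
    (z : Site (d + 1)) (μ ν : Fin (d + 1)) :
    ‖curlAt (flat (d := d + 1) (n := n))
      ((fun (x : Site (d + 1)) (κ : Fin (d + 1)) => Matrix.of fun i i' : n =>
          (HkOp (L ^ (j + 1)) M *ᵥ fun p : Tor M × Fin (d + 1) => ((((((L ^ (j + 1) : ℕ) : ℂ))⁻¹) • Φ) p i i')) (toT (fine (L ^ (j + 1)) M) x, κ))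
        + dPot (interp (L ^ (j + 1)) Finset.univ (framePot L (j + 1)
            (fun (x : Site (d + 1)) (κ : Fin (d + 1)) => Matrix.of fun i i' : n =>
              (HkOp (L ^ (j + 1)) M *ᵥ fun p : Tor M × Fin (d + 1) => ((((((L ^ (j + 1) : ℕ) : ℂ))⁻¹) • Φ) p i i')) (toT (fine (L ^ (j + 1)) M) x, κ)))))
      z μ ν‖
      ≤ Fintype.card n * (2 * (CdecD d * (((d : ℝ) + 1) * (2 * ((d : ℝ) + 1))
          * ((2 + 32 / (kappa163 (d + 1) / (d + 1)) ^ 2) * latticeConst (d + 1) (kappa163 (d + 1) / (d + 1) / 2)))))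
        * f / (((L ^ (j + 1) : ℕ) : ℝ)) ^ 2 := by
  have hnR0 : (0 : ℝ) < (((L ^ (j + 1) : ℕ)) : ℝ) := by exact_mod_cast Nat.pos_of_ne_zero (NeZero.ne (L ^ (j + 1)))
  have hF' : ∀ (i i' : n) (y : Tor M) (μ ν : Fin (d + 1)),
      ‖Fs M 1 (fun p : Tor M × Fin (d + 1) => ((((((L ^ (j + 1) : ℕ) : ℂ))⁻¹) • Φ) p i i')) μ ν y‖ ≤ f / (((L ^ (j + 1) : ℕ)) : ℝ) := by
    intro i i' y μ' ν'
    rw [Fs_one_entry_smul M ((((L ^ (j + 1) : ℕ) : ℂ))⁻¹) Φ i i' μ' ν' y, norm_mul, norm_inv, Complex.norm_natCast, div_eq_inv_mul]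
    exact mul_le_mul_of_nonneg_left (hF i i' y μ' ν') (inv_nonneg.mpr hnR0.le)
  have h := norm_curlAt_flat_hkRightInverse_le (n := n) L j M (((((L ^ (j + 1) : ℕ) : ℂ))⁻¹) • Φ) hF' z μ ν
  refine h.trans (le_of_eq ?_)
  field_simp

end

end Summit.QuantumFields.BalabanUV.T4Continuum.NE7FlatHkCurlLetterHolonomy
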